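import Mathlib.Analysis.Normed.Affine.MazurUlam
import Mathlib.Analysis.InnerProductSpace.PiL2
import HarnessLib
import Literature.Geometry.DiscreteGeometry.KissingPatterns
import Literature.MathematicalPhysics.StatisticalMechanics.MuGroundStateConfiguration

/-!
# Line `birth` of crux `FreeSplittingCertificates.ShellRigidityHcp` (stmt-AtomisticToContinuum-12561): stub `stub_windowTransfer`

A ball matching against a rigid image of a point set is a two-sided window matching against its
linear part.  At the end of the lead's compactness argument the limit set is `Y = g '' Λ` (with
`Λ` a point set of `ℝ³` and `g` a Euclidean isometry) with `0 ∈ Y`, and the configuration `Z`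
is `BallMatch`-ed to `Y` on the ball `‖·‖ ≤ R'` about `0`.  The crux wants this matching
phrased against `A (Λ - q)` with `q ∈ Λ` and `A` a *linear* isometry; this file is that
rephrasing.

Proof: pick `q ∈ Λ` with `g q = 0`.  By the Mazur–Ulam theorem
(`IsometryEquiv.toRealLinearIsometryEquiv`, Mathlib) `A := x ↦ g x - g 0` is a linear isometry,
hence `A (x - q) = A x - A q = (g x - g 0) - (g q - g 0) = g x` for all `x`.  The two halves of
`BallMatch ε' R' 0 Z (g '' Λ)` are then literally the two window statements, using
`dist (g p) 0 = dist (g p) (g q) = dist p q` and `dist z 0 = ‖z‖`.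

Sources: Mazur–Ulam (Mathlib, `Mathlib/Analysis/Normed/Affine/MazurUlam.lean`); the definition
`BallMatch` (`Literature/MathematicalPhysics/StatisticalMechanics/MuGroundStateConfiguration.lean`).
Folklore.
-/

noncomputable section

namespace Summit.AtomisticToContinuum.Crystallization.Theorems.ShellRigidityHcpBirth

open Literature.Geometry.DiscreteGeometry Literature.MathematicalPhysics.StatisticalMechanics

/-- Mazur–Ulam rephrasing: for a Euclidean isometry `g` with `g q = 0`, the linear isometry
`A := x ↦ g x - g 0` (the linear part of `g`) satisfies `A (x - q) = g x`. [folklore] -/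
private theorem linearPart_apply_sub
    (g : EuclideanSpace ℝ (Fin 3) ≃ᵢ EuclideanSpace ℝ (Fin 3)) {q : EuclideanSpace ℝ (Fin 3)}
    (hq : g q = 0) (x : EuclideanSpace ℝ (Fin 3)) :
    g.toRealLinearIsometryEquiv.toLinearIsometry (x - q) = g x := by
  rw [LinearIsometryEquiv.coe_toLinearIsometry, LinearIsometryEquiv.map_sub,
    IsometryEquiv.toRealLinearIsometryEquiv_apply, IsometryEquiv.toRealLinearIsometryEquiv_apply,
    hq, zero_sub, sub_neg_eq_add, sub_add_cancel]

/-- **stub_windowTransfer** (a ball matching against a rigid image of a point set is a two-sided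
window matching against its linear part).  If `0 ∈ g '' Λ` for a Euclidean isometry `g` and `Z`
is two-way `ε'`-matched to `g '' Λ` on the ball `‖·‖ ≤ R'` about `0`, then there are `q ∈ Λ`
(with `g q = 0`) and a linear isometry `A` (the linear part of `g`, so `g x = A (x - q)`) such
that every `p ∈ Λ` with `dist p q ≤ R'` has some `z ∈ Z` within `ε'` of `A (p - q)`, and every
`z ∈ Z` with `‖z‖ ≤ R'` is within `ε'` of some `A (p - q)`, `p ∈ Λ`. [folklore] -/
theorem stub_windowTransfer :
    ∀ (Λ Z : Set (EuclideanSpace ℝ (Fin 3)))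
      (g : EuclideanSpace ℝ (Fin 3) ≃ᵢ EuclideanSpace ℝ (Fin 3)) (ε' R' : ℝ),
      (0 : EuclideanSpace ℝ (Fin 3)) ∈ g '' Λ → BallMatch ε' R' 0 Z (g '' Λ) →
      ∃ q ∈ Λ, ∃ A : EuclideanSpace ℝ (Fin 3) →ₗᵢ[ℝ] EuclideanSpace ℝ (Fin 3),
        (∀ p ∈ Λ, dist p q ≤ R' → ∃ z ∈ Z, dist z (A (p - q)) ≤ ε') ∧
        (∀ z ∈ Z, ‖z‖ ≤ R' → ∃ p ∈ Λ, dist z (A (p - q)) ≤ ε') := by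
  intro Λ Z g ε' R' h0 hBM
  obtain ⟨q, hqΛ, hq⟩ := h0
  refine ⟨q, hqΛ, g.toRealLinearIsometryEquiv.toLinearIsometry, ?_, ?_⟩
  · intro p hp hpq
    have hn : dist (g p) 0 ≤ R' := by
      calc dist (g p) 0 = dist (g p) (g q) := by rw [hq]
        _ = dist p q := g.dist_eq p q
        _ ≤ R' := hpq
    obtain ⟨z, hz, hzs⟩ := hBM.1 (g p) (Set.mem_image_of_mem g hp) hn
    exact ⟨z, hz, by rwa [linearPart_apply_sub g hq p]⟩
  · intro z hz hzn
    have hz0 : dist z 0 ≤ R' := by rwa [dist_zero_right]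
    obtain ⟨s, ⟨p, hp, rfl⟩, hzs⟩ := hBM.2 z hz hz0
    exact ⟨p, hp, by rwa [linearPart_apply_sub g hq p]⟩

end Summit.AtomisticToContinuum.Crystallization.Theorems.ShellRigidityHcpBirth

end
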